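import Literature.NumberTheory.Transcendental.MasserSchneiderTauRun
import Literature.NumberTheory.Transcendental.MasserLemma22
import HarnessLib

/-!
# Masser 1975 — `τ = ω₂/ω₁` is transcendental (no complex multiplication): parameters, conclusion

Conclusion of `MasserSchneiderTau.lean` / `MasserSchneiderTauRun.lean` (support for the book's
proof of Theorem II, `Literature.NumberTheory.Transcendental.masser_ellipticPeriods`): the choice
of the parameters `k = [ℓ^a], L = [ℓ^b], h = [ℓ^g], k₁ = [ℓ^{a₁}], h₁ = [ℓ^{g₁}]` for a free
large real `ℓ` (the exponents of `MasserThmIParams.lean` with `ε = ½`), the verification of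
`Run6.Hyp`, and the theorem

* `transcendental_tau` — **for a lattice with algebraic invariants and without complex
  multiplication, `ω₂/ω₁` is transcendental** (Schneider 1937; in Masser's book the
  qualitative content of Theorem I, used on p. 26).

Everything here is proved; no named facts.

## References

* D. W. Masser, *Elliptic Functions and Transcendence*, Lecture Notes in Math. 437, Springer 1975,
  Ch. I §1.3, Ch. II §2.5 (p. 26). [Masser1975]
* Th. Schneider, *Arithmetische Untersuchungen elliptischer Integrale*, Math. Ann. 113 (1937),
  1–13. [Schneider1937]
-/

noncomputable section

open Real Filter Asymptotics Complex

namespace Literature.NumberTheory.Transcendental.Masser1975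

/-- The fixed `ε = ½` whose exponents `a, b, g, a₁, g₁` (`δ = 1/200`) we reuse. [folklore] -/
def εS : ℝ := 1 / 2

/-- `0 < εS ≤ ½`. [folklore] -/
theorem εS_bounds : 0 < εS ∧ εS ≤ 1 / 2 := by unfold εS; norm_num

/-- The fixed data: the setup (lattice, algebraic `τ` of degree `≥ 3`) and its constants. [folklore] -/
structure PData6 where
  /-- the setup -/
  S : ASetup
  /-- the constants of the lattice -/
  K : Consts S.L

namespace PData6

variable (D : PData6)

/-- **The master constant** `Cb ≥ 10` dominating all the constants of the run. [cite: Masser1975, §1.3] -/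
def Cb : ℝ := 10 + Real.log D.S.C6 + Real.log (siegelConst D.S.K6) + D.S.G6.h + D.K.CG + D.K.Cσ +
  |Real.log D.K.cσ| + D.K.Cu + D.K.C₁₀ + |Real.log D.K.κ| + D.K.R + Real.log D.K.d.ρ⁻¹ +
  Real.log (max 1 ‖D.S.L.ω₁‖⁻¹) + |Real.log ‖D.S.L.ω₁‖| + Real.log D.S.G6.M + D.K.N₀ + Real.log |(D.S.d6 : ℝ)|

/-- All the summands are non-negative and dominated by `Cb`; `Cb ≥ 10`. [folklore] -/
theorem consts_le_Cb : 10 ≤ D.Cb ∧ Real.log D.S.C6 ≤ D.Cb ∧ Real.log (siegelConst D.S.K6) ≤ D.Cb ∧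
    (D.S.G6.h : ℝ) ≤ D.Cb ∧ D.K.CG ≤ D.Cb ∧ D.K.Cσ ≤ D.Cb ∧ |Real.log D.K.cσ| ≤ D.Cb ∧ D.K.Cu ≤ D.Cb ∧
    (D.K.C₁₀ : ℝ) ≤ D.Cb ∧ |Real.log D.K.κ| ≤ D.Cb ∧ D.K.R ≤ D.Cb ∧ Real.log D.K.d.ρ⁻¹ ≤ D.Cb ∧
    Real.log (max 1 ‖D.S.L.ω₁‖⁻¹) ≤ D.Cb ∧ |Real.log ‖D.S.L.ω₁‖| ≤ D.Cb ∧ Real.log D.S.G6.M ≤ D.Cb ∧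
    (D.K.N₀ : ℝ) ≤ D.Cb ∧ Real.log |(D.S.d6 : ℝ)| ≤ D.Cb := by
  have h1 : 0 ≤ Real.log D.S.C6 := Real.log_nonneg D.S.one_le_C6
  have h2 : 0 ≤ Real.log (siegelConst D.S.K6) := Real.log_nonneg (one_le_siegelConst _)
  have h3 : 0 ≤ (D.S.G6.h : ℝ) := Nat.cast_nonneg _
  have h4 := D.K.hCG0
  have h5 := D.K.hCσ
  have h6 : 0 ≤ |Real.log D.K.cσ| := abs_nonneg _
  have h7 := D.K.hCu0
  have h8 : 0 ≤ (D.K.C₁₀ : ℝ) := Nat.cast_nonneg _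
  have h9 : 0 ≤ |Real.log D.K.κ| := abs_nonneg _
  have h10 := D.K.hR.le
  have h11 : 0 ≤ Real.log D.K.d.ρ⁻¹ := Real.log_nonneg (one_le_inv₀ D.K.d.ρ_pos |>.mpr
    (D.K.d.ρ_le.trans (by norm_num)))
  have h13 : 0 ≤ Real.log (max 1 ‖D.S.L.ω₁‖⁻¹) := Real.log_nonneg (le_max_left _ _)
  have h14 : 0 ≤ |Real.log ‖D.S.L.ω₁‖| := abs_nonneg _
  have h15 : 0 ≤ Real.log D.S.G6.M := Real.log_nonneg D.S.G6.one_le_M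
  have h16 : 0 ≤ (D.K.N₀ : ℝ) := Nat.cast_nonneg _
  have h17 : 0 ≤ Real.log |(D.S.d6 : ℝ)| := Real.log_nonneg D.S.G6.one_le_abs_den
  unfold Cb
  refine ⟨?_, ?_, ?_, ?_, ?_, ?_, ?_, ?_, ?_, ?_, ?_, ?_, ?_, ?_, ?_, ?_, ?_⟩ <;> linarith

/-- `1 ≤ Cb`. [folklore] -/
theorem one_le_Cb : 1 ≤ D.Cb := le_trans (by norm_num) D.consts_le_Cb.1

/-! ### The parameters as functions of the free large real `ℓ` -/

/-- `k = [ℓ^a]`. [cite: Masser1975, §1.3 (p. 5)] -/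
def kOf (ℓ : ℝ) : ℕ := ⌊ℓ ^ ea εS⌋₊
/-- `L = [ℓ^b]`. [cite: Masser1975, §1.3 (p. 5)] -/
def nOf (ℓ : ℝ) : ℕ := ⌊ℓ ^ eb εS⌋₊
/-- `h = [ℓ^g]`. [cite: Masser1975, §1.3 (11)] -/
def hOf (ℓ : ℝ) : ℕ := ⌊ℓ ^ eg εS⌋₊
/-- `k₁ = [ℓ^{a₁}]`. [cite: Masser1975, §1.3] -/
def k₁Of (ℓ : ℝ) : ℕ := ⌊ℓ ^ ea₁ εS⌋₊
/-- `h₁ = [ℓ^{g₁}]`. [cite: Masser1975, §1.3 (15)] -/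
def h₁Of (ℓ : ℝ) : ℕ := ⌊ℓ ^ eg₁ εS⌋₊

/-- **The atomic largeness conditions on `ℓ`.** [cite: Masser1975, §1.3 ("k > c sufficiently large")] -/
structure LargeL (ℓ : ℝ) : Prop where
  hℓ : 1 ≤ ℓ
  hlog : Real.log (42 * ℓ ^ ea₁ εS + 42) ≤ ℓ ^ dδ εS
  h2a : 2 ≤ ℓ ^ ea εS
  h2b : 2 * (D.K.N₀ + 1 : ℝ) ≤ ℓ ^ eb εS
  h2g : 2 ≤ ℓ ^ eg εS
  h2a₁ : 2 ≤ ℓ ^ ea₁ εS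
  h2g₁ : 2 ≤ ℓ ^ eg₁ εS
  hG1 : 3000 * D.Cb ^ 2 * ℓ ^ (ea εS + 1) ≤ ℓ ^ (ea εS + eg εS)
  hG2 : 40000 * D.Cb * ℓ ^ (eb εS + 2 * eg εS) ≤ ℓ ^ (ea εS + eg εS)
  hG3 : 40000 * D.Cb ^ 2 * ℓ ^ (ea₁ εS + 1) ≤ ℓ ^ (ea εS + eg εS)
  hH1 : 3000 * D.Cb ^ 2 * ℓ ^ (ea εS + 1) ≤ ℓ ^ (ea₁ εS + eg₁ εS)
  hH2 : 40000 * D.Cb * ℓ ^ (eb εS + 2 * eg₁ εS) ≤ ℓ ^ (ea₁ εS + eg₁ εS)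
  hH3 : 4000 * D.Cb ^ 3 * ℓ ^ (3 * eb εS) ≤ ℓ ^ (ea₁ εS + eg₁ εS)
  hH4 : 4000 * D.Cb ^ 2 * ℓ ^ (eb εS + 1) ≤ ℓ ^ (ea₁ εS + eg₁ εS)
  hS1 : 32 * ℓ ^ ea εS ≤ ℓ ^ (2 * eb εS)
  hS2 : 4 * D.Cb * ℓ ^ eb εS ≤ ℓ ^ eg₁ εS

/-- The exponent facts used below (`ε = ½`). [folklore] -/
theorem exps : 1 < eg εS ∧ eb εS + eg εS < ea εS ∧ ea εS < 2 * eb εS ∧ eb εS < eg₁ εS ∧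
    eb εS + eg₁ εS < ea₁ εS ∧ ea εS ≤ ea₁ εS ∧ 0 < dδ εS ∧ dδ εS ≤ 1 / 200 ∧ 0 < eb εS ∧
    ea₁ εS + 1 < ea εS + eg εS ∧ eb εS + 2 * eg εS < ea εS + eg εS ∧
    3 * eb εS < ea₁ εS + eg₁ εS ∧ ea εS + 1 < ea₁ εS + eg₁ εS ∧ eb εS + 1 < ea₁ εS + eg₁ εS ∧
    eb εS + 2 * eg₁ εS < ea₁ εS + eg₁ εS ∧ 0 < eg εS ∧ 0 < ea εS ∧ 0 < ea₁ εS ∧ 0 < eg₁ εS := by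
  obtain ⟨h1, h2, h3, h4, h5, h6, h7, h8, h9, -, -, -, -, -, -, -, h17, h18, h19, h20, h21, h22, h23, h24, h25, h26⟩ :=
    exps_facts εS_bounds.1 εS_bounds.2
  exact ⟨h1, h2, h3, h4, h5, h6, h21, (dδ_bounds εS_bounds.1 εS_bounds.2).2, h22, h7, h9, h17, h18, h19,
    h20, h23, h24, h25, h26⟩

/-- **All the largeness conditions hold for `ℓ` large.** [cite: Masser1975, §1.3] -/
theorem eventually_largeL : ∀ᶠ ℓ in atTop, D.LargeL ℓ := by
  obtain ⟨hg1, hbga, ha2b, hbg₁, hbg₁a₁, haa₁, hd0, hd1, hb0, ha₁1ag, hb2gag, h3b, ha1, hb1, hb2g₁, hg0, ha0,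
    ha₁0, hg₁0⟩ := exps
  have hCb := D.one_le_Cb
  have t := fun (c : ℝ) {e₁ e₂ : ℝ} (h : e₁ < e₂) => eventually_mul_rpow_le_rpow c h
  have tlog := eventually_log_le_rpow hd0 (A := 42) (e := ea₁ εS) (by norm_num) ha₁0.le
  have t2 : ∀ {e : ℝ}, 0 < e → ∀ c : ℝ, ∀ᶠ x : ℝ in atTop, c ≤ x ^ e := fun he c =>
    (tendsto_rpow_atTop he).eventually_ge_atTop c
  filter_upwards [eventually_ge_atTop (1 : ℝ), tlog, t2 ha0 2, t2 hb0 (2 * (D.K.N₀ + 1 : ℝ)),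
    t2 hg0 2, t2 ha₁0 2, t2 hg₁0 2,
    t (3000 * D.Cb ^ 2) (by linarith : ea εS + 1 < ea εS + eg εS),
    t (40000 * D.Cb) (by linarith : eb εS + 2 * eg εS < ea εS + eg εS),
    t (40000 * D.Cb ^ 2) (by linarith : ea₁ εS + 1 < ea εS + eg εS),
    t (3000 * D.Cb ^ 2) (by linarith : ea εS + 1 < ea₁ εS + eg₁ εS),
    t (40000 * D.Cb) (by linarith : eb εS + 2 * eg₁ εS < ea₁ εS + eg₁ εS),
    t (4000 * D.Cb ^ 3) (by linarith : 3 * eb εS < ea₁ εS + eg₁ εS),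
    t (4000 * D.Cb ^ 2) (by linarith : eb εS + 1 < ea₁ εS + eg₁ εS),
    t 32 (by linarith : ea εS < 2 * eb εS),
    t (4 * D.Cb) (by linarith : eb εS < eg₁ εS)]
    with ℓ h1 h2 h3 h4 h5 h6 h7 h8 h9 h10 h11 h12 h13 h14 h15 h16
  exact ⟨h1, h2, h3, h4, h5, h6, h7, h8, h9, h10, h11, h12, h13, h14, h15, h16⟩

section Bounds

variable {D} {ℓ : ℝ} (hL : D.LargeL ℓ)
include hL

/-- `0 < ℓ`. [folklore] -/
theorem ℓ_pos : 0 < ℓ := lt_of_lt_of_le one_pos hL.hℓ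

/-- Monotonicity of `ℓ^e` in `e` (`ℓ ≥ 1`). [folklore] -/
theorem rpow_mono {e₁ e₂ : ℝ} (h : e₁ ≤ e₂) : ℓ ^ e₁ ≤ ℓ ^ e₂ :=
  Real.rpow_le_rpow_of_exponent_le hL.hℓ h

/-- `1 ≤ ℓ^e` for `e ≥ 0`. [folklore] -/
theorem one_le_rpow' {e : ℝ} (he : 0 ≤ e) : 1 ≤ ℓ ^ e := Real.one_le_rpow hL.hℓ he

/-- rpow products at `ℓ`. [folklore] -/
theorem rpow_add' (u v : ℝ) : ℓ ^ (u + v) = ℓ ^ u * ℓ ^ v := Real.rpow_add (ℓ_pos hL) u v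

/-- `ℓ^{2u} = ℓ^u ℓ^u`. [folklore] -/
theorem rpow_two' (u : ℝ) : ℓ ^ (2 * u) = ℓ ^ u * ℓ ^ u := by rw [two_mul, rpow_add' hL]

/-- `ℓ^{3u} = ℓ^u ℓ^u ℓ^u`. [folklore] -/
theorem rpow_three' (u : ℝ) : ℓ ^ (3 * u) = ℓ ^ u * ℓ ^ u * ℓ ^ u := by
  rw [show 3 * u = u + u + u by ring, rpow_add' hL, rpow_add' hL]

/-- `k ≤ ℓ^a`, `ℓ^a/2 ≤ k`, `1 ≤ k`. [folklore] -/
theorem k_bounds : (kOf ℓ : ℝ) ≤ ℓ ^ ea εS ∧ ℓ ^ ea εS / 2 ≤ kOf ℓ ∧ 1 ≤ kOf ℓ := by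
  have h := floor_sandwich hL.h2a
  refine ⟨h.2, h.1, ?_⟩
  have : (1 : ℝ) ≤ (⌊ℓ ^ ea εS⌋₊ : ℝ) := by linarith [h.1, hL.h2a]
  exact_mod_cast this

/-- `n ≤ ℓ^b`, `ℓ^b/2 ≤ n`, `N₀ + 1 ≤ n`. [folklore] -/
theorem n_bounds : (nOf ℓ : ℝ) ≤ ℓ ^ eb εS ∧ ℓ ^ eb εS / 2 ≤ nOf ℓ ∧ D.K.N₀ + 1 ≤ nOf ℓ := by
  have hN : (2 : ℝ) ≤ ℓ ^ eb εS := by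
    have := hL.h2b; have : (0 : ℝ) ≤ D.K.N₀ := Nat.cast_nonneg _; linarith
  have h := floor_sandwich hN
  refine ⟨h.2, h.1, ?_⟩
  have : ((D.K.N₀ + 1 : ℕ) : ℝ) ≤ (⌊ℓ ^ eb εS⌋₊ : ℝ) := by push_cast; linarith [h.1, hL.h2b]
  exact_mod_cast this

/-- `h ≤ ℓ^g`, `ℓ^g/2 ≤ h`, `1 ≤ h`. [folklore] -/
theorem h_bounds : (hOf ℓ : ℝ) ≤ ℓ ^ eg εS ∧ ℓ ^ eg εS / 2 ≤ hOf ℓ ∧ 1 ≤ hOf ℓ := by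
  have h := floor_sandwich hL.h2g
  refine ⟨h.2, h.1, ?_⟩
  have : (1 : ℝ) ≤ (⌊ℓ ^ eg εS⌋₊ : ℝ) := by linarith [h.1, hL.h2g]
  exact_mod_cast this

/-- `k₁ ≤ ℓ^{a₁}`, `ℓ^{a₁}/2 ≤ k₁`, `1 ≤ k₁`. [folklore] -/
theorem k₁_bounds : (k₁Of ℓ : ℝ) ≤ ℓ ^ ea₁ εS ∧ ℓ ^ ea₁ εS / 2 ≤ k₁Of ℓ ∧ 1 ≤ k₁Of ℓ := by
  have h := floor_sandwich hL.h2a₁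
  refine ⟨h.2, h.1, ?_⟩
  have : (1 : ℝ) ≤ (⌊ℓ ^ ea₁ εS⌋₊ : ℝ) := by linarith [h.1, hL.h2a₁]
  exact_mod_cast this

/-- `h₁ ≤ ℓ^{g₁}`, `ℓ^{g₁}/2 ≤ h₁`, `1 ≤ h₁`. [folklore] -/
theorem h₁_bounds : (h₁Of ℓ : ℝ) ≤ ℓ ^ eg₁ εS ∧ ℓ ^ eg₁ εS / 2 ≤ h₁Of ℓ ∧ 1 ≤ h₁Of ℓ := by
  have h := floor_sandwich hL.h2g₁
  refine ⟨h.2, h.1, ?_⟩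
  have : (1 : ℝ) ≤ (⌊ℓ ^ eg₁ εS⌋₊ : ℝ) := by linarith [h.1, hL.h2g₁]
  exact_mod_cast this

/-- `n ≤ k ≤ k₁` and `h, h₁, n, k ≤ ℓ^{a₁}`. [folklore] -/
theorem params_order : nOf ℓ ≤ kOf ℓ ∧ kOf ℓ ≤ k₁Of ℓ ∧ nOf ℓ ≤ k₁Of ℓ ∧
    (kOf ℓ : ℝ) ≤ ℓ ^ ea₁ εS ∧ (nOf ℓ : ℝ) ≤ ℓ ^ ea₁ εS ∧ (hOf ℓ : ℝ) ≤ ℓ ^ ea₁ εS ∧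
    (h₁Of ℓ : ℝ) ≤ ℓ ^ ea₁ εS := by
  obtain ⟨hg1, hbga, -, hbg₁, hbg₁a₁, haa₁, -, -, hb0, -⟩ := exps
  have hba : eb εS ≤ ea εS := by linarith
  have hnk : nOf ℓ ≤ kOf ℓ := Nat.floor_le_floor (rpow_mono hL hba)
  have hkk₁ : kOf ℓ ≤ k₁Of ℓ := Nat.floor_le_floor (rpow_mono hL haa₁)
  refine ⟨hnk, hkk₁, hnk.trans hkk₁, (k_bounds hL).1.trans (rpow_mono hL haa₁),
    (n_bounds hL).1.trans (rpow_mono hL (hba.trans haa₁)),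
    (h_bounds hL).1.trans (rpow_mono hL (by linarith)), (h₁_bounds hL).1.trans (rpow_mono hL (by linarith))⟩

/-- `1 ≤ ℓ^δ ≤ ℓ`. [folklore] -/
theorem ℓδ_bounds : 1 ≤ ℓ ^ dδ εS ∧ ℓ ^ dδ εS ≤ ℓ := by
  obtain ⟨-, -, -, -, -, -, hd0, hd1, -⟩ := exps
  refine ⟨one_le_rpow' hL hd0.le, ?_⟩
  calc ℓ ^ dδ εS ≤ ℓ ^ (1 : ℝ) := rpow_mono hL (by linarith)
    _ = ℓ := Real.rpow_one ℓ

/-- **Small logarithms**: `log x ≤ ℓ^δ` whenever `0 < x ≤ 42 ℓ^{a₁} + 42`. [folklore] -/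
theorem log_le_ℓδ {x : ℝ} (hx : 0 < x) (hx' : x ≤ 42 * ℓ ^ ea₁ εS + 42) :
    Real.log x ≤ ℓ ^ dδ εS :=
  (Real.log_le_log hx hx').trans hL.hlog

/-- The instances used: `log(14(2n+K+1))`, `log(K+1)`, `log(6 hh + 7)`, … [folklore] -/
theorem log_small {x : ℝ} (hx : 0 < x) {u v : ℝ} (hu : u ≤ ℓ ^ ea₁ εS) (hv : v ≤ ℓ ^ ea₁ εS)
    (hx' : x ≤ 14 * (2 * u + v + 1)) : Real.log x ≤ ℓ ^ dδ εS :=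
  log_le_ℓδ hL hx (by nlinarith)

end Bounds

/-! ### The run and the bounds for its explicit quantities -/

/-- **The run** at the free parameter `ℓ`. [cite: Masser1975, §1.3 (p. 5)] -/
def run (ℓ : ℝ) : Run6 where
  S := D.S
  K := D.K
  k := kOf ℓ
  n := nOf ℓ
  h := hOf ℓ
  k₁ := k₁Of ℓ
  h₁ := h₁Of ℓ

section RunBounds

variable {D} {ℓ : ℝ} (hL : D.LargeL ℓ)
include hL

/-- `Amat₆(n, K) ≤ e^{10 Cb K ℓ}` for `n ≤ K ≤ ℓ^{a₁}`, `1 ≤ K`. [folklore] -/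
theorem Amat6_le {K : ℕ} (hnK : nOf ℓ ≤ K) (hK1 : 1 ≤ K) (hKℓ : (K : ℝ) ≤ ℓ ^ ea₁ εS) :
    D.S.Amat6 (nOf ℓ) K ≤ Real.exp (10 * D.Cb * K * ℓ) := by
  obtain ⟨-, hC0, -⟩ := D.consts_le_Cb
  have hℓ := hL.hℓ
  have hCb := D.one_le_Cb
  obtain ⟨hδ1, hδℓ⟩ := ℓδ_bounds hL
  obtain ⟨-, -, -, -, hnℓ, -⟩ := params_order hL
  have hK : (1 : ℝ) ≤ K := by exact_mod_cast hK1
  have hnK' : (nOf ℓ : ℝ) ≤ K := by exact_mod_cast hnK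
  have hC00 : 0 ≤ D.S.C6 := zero_le_one.trans D.S.one_le_C6
  have f1 : D.S.C6 ^ (2 * nOf ℓ + 2 * K) ≤ Real.exp (((2 * nOf ℓ + 2 * K : ℕ) : ℝ) * D.Cb) :=
    pow_le_exp hC00 (le_exp_of_log_le (by linarith [D.S.one_le_C6]) hC0) _
  have hx0 : (0 : ℝ) < 14 * ((2 * nOf ℓ + K + 1 : ℕ) : ℝ) := by positivity
  have f3 : (14 * ((2 * nOf ℓ + K + 1 : ℕ) : ℝ)) ^ K ≤ Real.exp ((K : ℝ) * ℓ ^ dδ εS) := by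
    refine pow_le_exp hx0.le (le_exp_of_log_le hx0 ?_) K
    exact log_small hL hx0 hnℓ hKℓ (by push_cast; nlinarith)
  obtain ⟨-, d2, -, -, -, d6, d7, d8⟩ := dom hK hCb hℓ (by linarith) hδℓ
  have hfin : ((2 * nOf ℓ + 2 * K : ℕ) : ℝ) * D.Cb + (K : ℝ) * ℓ ^ dδ εS ≤ 10 * D.Cb * K * ℓ := by
    push_cast
    have : (2 * (nOf ℓ : ℝ) + 2 * K) * D.Cb ≤ 4 * ((K : ℝ) * D.Cb) := by nlinarith
    nlinarith
  unfold ASetup.Amat6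
  exact (mul_le_exp (pow_nonneg hC00 _) f1 f3).trans (Real.exp_le_exp.mpr hfin)

/-- `n + 1 ≤ e^{ℓ^δ}`. [folklore] -/
theorem n_succ_le_exp : (nOf ℓ : ℝ) + 1 ≤ Real.exp (ℓ ^ dδ εS) := by
  obtain ⟨-, -, -, -, hnℓ, -⟩ := params_order hL
  exact le_exp_of_log_le (by positivity) (log_small hL (by positivity) hnℓ hnℓ
    (by nlinarith [Nat.cast_nonneg (α := ℝ) (nOf ℓ)]))

/-- `Pb₆(n, k) ≤ e^{14 Cb k ℓ}`. [folklore] -/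
theorem Pb6_le : D.S.Pb6 (nOf ℓ) (kOf ℓ) ≤ Real.exp (14 * D.Cb * kOf ℓ * ℓ) := by
  obtain ⟨-, -, hCK, -⟩ := D.consts_le_Cb
  obtain ⟨hnk, -, -, hkℓ, -⟩ := params_order hL
  obtain ⟨-, -, hk1⟩ := k_bounds hL
  have hk : (1 : ℝ) ≤ kOf ℓ := by exact_mod_cast hk1
  have hℓ := hL.hℓ
  have hCb := D.one_le_Cb
  obtain ⟨hδ1, hδℓ⟩ := ℓδ_bounds hL
  have hC : siegelConst D.S.K6 ≤ Real.exp D.Cb :=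
    le_exp_of_log_le (lt_of_lt_of_le one_pos (one_le_siegelConst _)) hCK
  have hsq : ((((nOf ℓ) + 1) ^ 2 : ℕ) : ℝ) ≤ Real.exp (2 * ℓ ^ dδ εS) := by
    have h := pow_le_exp (by positivity) (n_succ_le_exp hL) 2
    push_cast at h ⊢; simpa using h
  have hA := Amat6_le hL hnk hk1 hkℓ
  have hC0 : 0 ≤ siegelConst D.S.K6 := zero_le_one.trans (one_le_siegelConst _)
  unfold ASetup.Pb6
  calc siegelConst D.S.K6 * (siegelConst D.S.K6 * ((((nOf ℓ) + 1) ^ 2 : ℕ) : ℝ) * D.S.Amat6 (nOf ℓ) (kOf ℓ))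
      ≤ Real.exp (D.Cb + (D.Cb + 2 * ℓ ^ dδ εS + 10 * D.Cb * kOf ℓ * ℓ)) :=
        mul_le_exp hC0 hC (mul_le_exp (by positivity) (mul_le_exp hC0 hC hsq) hA)
    _ ≤ Real.exp (14 * D.Cb * kOf ℓ * ℓ) := Real.exp_le_exp.mpr (by
        obtain ⟨-, -, d3, -, d5, -⟩ := dom hk hCb hℓ (by linarith) hδℓ
        nlinarith)

/-- `Pc ≤ e^{16 Cb k ℓ}`. [folklore] -/
theorem Pc_le : (D.run ℓ).Pc ≤ Real.exp (16 * D.Cb * kOf ℓ * ℓ) := by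
  obtain ⟨-, -, hk1⟩ := k_bounds hL
  have hk : (1 : ℝ) ≤ kOf ℓ := by exact_mod_cast hk1
  have hℓ := hL.hℓ
  have hCb := D.one_le_Cb
  obtain ⟨hδ1, hδℓ⟩ := ℓδ_bounds hL
  have hsq : ((((nOf ℓ) + 1) ^ 2 : ℕ) : ℝ) ≤ Real.exp (2 * ℓ ^ dδ εS) := by
    have h := pow_le_exp (by positivity) (n_succ_le_exp hL) 2
    push_cast at h ⊢; simpa using h
  change ((((nOf ℓ) + 1) ^ 2 : ℕ) : ℝ) * D.S.Pb6 (nOf ℓ) (kOf ℓ) ≤ _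
  calc _ ≤ Real.exp (2 * ℓ ^ dδ εS + 14 * D.Cb * kOf ℓ * ℓ) := mul_le_exp (by positivity) hsq (Pb6_le hL)
    _ ≤ _ := Real.exp_le_exp.mpr (by
        obtain ⟨-, -, -, -, d5, -⟩ := dom hk hCb hℓ (by linarith) hδℓ
        nlinarith)

/-- `Θ(hh) ≤ exp(16 Cb k ℓ + 26 Cb (n+1)(hh+1)²)`. [cite: Masser1975, Lemma 1.9] -/
theorem Θgen_le (hh : ℕ) : (D.run ℓ).Θgen hh ≤
    Real.exp (16 * D.Cb * kOf ℓ * ℓ + 26 * D.Cb * ((nOf ℓ : ℝ) + 1) * ((hh : ℝ) + 1) ^ 2) := by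
  obtain ⟨-, -, -, -, hCG, -⟩ := D.consts_le_Cb
  have hPc0 : 0 ≤ (D.run ℓ).Pc := (D.run ℓ).Pc_nonneg
  have f2 : Real.exp (D.K.CG * ((nOf ℓ : ℝ) + 1) * (1 + (5 * ((hh : ℝ) + 1)) ^ 2)) ≤
      Real.exp (26 * D.Cb * ((nOf ℓ : ℝ) + 1) * ((hh : ℝ) + 1) ^ 2) := by
    refine Real.exp_le_exp.mpr ?_
    have h1 : (1 + (5 * ((hh : ℝ) + 1)) ^ 2) ≤ 26 * ((hh : ℝ) + 1) ^ 2 := by nlinarith [Nat.cast_nonneg (α := ℝ) hh]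
    have h2 : 0 ≤ D.K.CG * ((nOf ℓ : ℝ) + 1) := mul_nonneg D.K.hCG0 (by positivity)
    calc D.K.CG * ((nOf ℓ : ℝ) + 1) * (1 + (5 * ((hh : ℝ) + 1)) ^ 2)
        ≤ D.K.CG * ((nOf ℓ : ℝ) + 1) * (26 * ((hh : ℝ) + 1) ^ 2) := mul_le_mul_of_nonneg_left h1 h2
      _ ≤ D.Cb * ((nOf ℓ : ℝ) + 1) * (26 * ((hh : ℝ) + 1) ^ 2) := by gcongr
      _ = _ := by ring
  change (D.run ℓ).Pc * Real.exp (D.K.CG * ((nOf ℓ : ℝ) + 1) * (1 + (5 * ((hh : ℝ) + 1)) ^ 2)) ≤ _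
  exact mul_le_exp hPc0 (Pc_le hL) f2

/-- **One extrapolation step, numerically** (exact zeros): for `K = [ℓ^{a_K}]`, `hh = [ℓ^{g_h}]`,
`Ggen(K, hh) ≤ e^{-ℓ^{a_K + g_h}/24}`. [cite: Masser1975, §1.3 (proofs of Lemmas 1.10, 1.11)] -/
theorem Ggen_le {aK gh : ℝ} (h2K : 2 ≤ ℓ ^ aK) (h2h : 2 ≤ ℓ ^ gh)
    (j1 : 3000 * D.Cb ^ 2 * ℓ ^ (ea εS + 1) ≤ ℓ ^ (aK + gh))
    (j2 : 40000 * D.Cb * ℓ ^ (eb εS + 2 * gh) ≤ ℓ ^ (aK + gh)) :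
    (D.run ℓ).Ggen ⌊ℓ ^ aK⌋₊ ⌊ℓ ^ gh⌋₊ ≤ Real.exp (-(ℓ ^ aK * ℓ ^ gh / 24)) := by
  set K := ⌊ℓ ^ aK⌋₊ with hKdef
  set hh := ⌊ℓ ^ gh⌋₊ with hhdef
  have hℓ := hL.hℓ
  have hℓ0 := ℓ_pos hL
  have hCb := D.one_le_Cb
  have hCb0 : 0 ≤ D.Cb := by linarith
  obtain ⟨hKle, hKge⟩ : (K : ℝ) ≤ ℓ ^ aK ∧ ℓ ^ aK / 2 ≤ K := ⟨(floor_sandwich h2K).2, (floor_sandwich h2K).1⟩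
  have hK1 : ℓ ^ aK ≤ (K : ℝ) + 1 := (Nat.lt_floor_add_one _).le
  obtain ⟨hhle, hhge⟩ : (hh : ℝ) ≤ ℓ ^ gh ∧ ℓ ^ gh / 2 ≤ hh := ⟨(floor_sandwich h2h).2, (floor_sandwich h2h).1⟩
  obtain ⟨hnle, -, -⟩ := n_bounds hL
  obtain ⟨hkle, -, -⟩ := k_bounds hL
  rw [rpow_add' hL, rpow_two' hL, rpow_add' hL] at j2
  rw [rpow_add' hL, Real.rpow_one, rpow_add' hL] at j1
  have hΘ := Θgen_le hL hh
  have hl65 := PData.log_six_fifths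
  -- `X = (K+1) hh log(6/5) ≥ A' G'/12`
  have Q1 : ℓ ^ aK * ℓ ^ gh / 12 ≤ (((K + 1) * hh : ℕ) : ℝ) * Real.log (6 / 5) := by
    have e1 : ℓ ^ aK * (ℓ ^ gh / 2) ≤ (((K + 1) * hh : ℕ) : ℝ) := by
      push_cast; exact mul_le_mul hK1 hhge (by positivity) (by positivity)
    calc ℓ ^ aK * ℓ ^ gh / 12 = ℓ ^ aK * (ℓ ^ gh / 2) * (1 / 6) := by ring
      _ ≤ (((K + 1) * hh : ℕ) : ℝ) * Real.log (6 / 5) := mul_le_mul e1 hl65.1 (by norm_num) (by positivity)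
  -- `LΘ ≤ X/2`
  have Q3 : ((nOf ℓ : ℝ) + 1) * ((hh : ℝ) + 1) ^ 2 ≤ 8 * (ℓ ^ eb εS * ℓ ^ gh * ℓ ^ gh) := by
    have hb1 : 1 ≤ ℓ ^ eb εS := one_le_rpow' hL (exps).2.2.2.2.2.2.2.2.1.le
    have e1 : (nOf ℓ : ℝ) + 1 ≤ 2 * ℓ ^ eb εS := by linarith
    have e2 : ((hh : ℝ) + 1) ^ 2 ≤ (2 * ℓ ^ gh) ^ 2 := by
      apply pow_le_pow_left₀ (by positivity); linarith
    calc ((nOf ℓ : ℝ) + 1) * ((hh : ℝ) + 1) ^ 2 ≤ 2 * ℓ ^ eb εS * (2 * ℓ ^ gh) ^ 2 :=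
          mul_le_mul e1 e2 (by positivity) (by positivity)
      _ = 8 * (ℓ ^ eb εS * ℓ ^ gh * ℓ ^ gh) := by ring
  have Q4 : D.Cb * ((nOf ℓ : ℝ) + 1) * ((hh : ℝ) + 1) ^ 2 ≤ 8 * (D.Cb * (ℓ ^ eb εS * ℓ ^ gh * ℓ ^ gh)) := by
    have := mul_le_mul_of_nonneg_left Q3 hCb0; linarith
  have R1 : D.Cb * (kOf ℓ : ℝ) * ℓ ≤ D.Cb * ((ℓ ^ ea εS) * ℓ) := by
    have := mul_le_mul_of_nonneg_left (mul_le_mul_of_nonneg_right hkle hℓ0.le) hCb0; linarith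
  have R2 : D.Cb * ((ℓ ^ ea εS) * ℓ) ≤ D.Cb ^ 2 * ((ℓ ^ ea εS) * ℓ) :=
    mul_le_mul_of_nonneg_right (le_self_pow₀ hCb two_ne_zero) (by positivity)
  have hAG0 : 0 ≤ ℓ ^ aK * ℓ ^ gh := by positivity
  have u1 : 16 * D.Cb * kOf ℓ * ℓ ≤ (16 / 3000) * (ℓ ^ aK * ℓ ^ gh) := by linarith only [R1, R2, j1]
  have u2 : 26 * D.Cb * ((nOf ℓ : ℝ) + 1) * ((hh : ℝ) + 1) ^ 2 ≤ (208 / 40000) * (ℓ ^ aK * ℓ ^ gh) :=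
    calc 26 * D.Cb * ((nOf ℓ : ℝ) + 1) * ((hh : ℝ) + 1) ^ 2
        = 26 * (D.Cb * ((nOf ℓ : ℝ) + 1) * ((hh : ℝ) + 1) ^ 2) := by ring
      _ ≤ 26 * (8 * (D.Cb * ((ℓ ^ eb εS) * (ℓ ^ gh) * (ℓ ^ gh)))) := by linarith only [Q4]
      _ = (208 / 40000) * (40000 * D.Cb * (ℓ ^ eb εS * (ℓ ^ gh * ℓ ^ gh))) := by ring
      _ ≤ (208 / 40000) * (ℓ ^ aK * ℓ ^ gh) := by linarith only [j2]
  have s2 : 16 * D.Cb * kOf ℓ * ℓ + 26 * D.Cb * ((nOf ℓ : ℝ) + 1) * ((hh : ℝ) + 1) ^ 2 ≤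
      (((K + 1) * hh : ℕ) : ℝ) * Real.log (6 / 5) / 2 := by linarith only [u1, u2, Q1, hAG0]
  -- assemble: `Ggen = Θ (5/6)^{(K+1)hh} ≤ exp(LΘ - X) ≤ exp(-X/2) ≤ exp(-A'G'/24)`
  have h56 : (5 / 6 : ℝ) ^ ((K + 1) * hh) = Real.exp (-((((K + 1) * hh : ℕ) : ℝ) * Real.log (6 / 5))) :=
    PData.five_sixths_pow _
  have hPc0 : 0 ≤ (D.run ℓ).Pc := (D.run ℓ).Pc_nonneg
  have hΘ0 : 0 ≤ (D.run ℓ).Θgen hh := by unfold Run6.Θgen; positivity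
  unfold Run6.Ggen
  rw [h56]
  refine (mul_le_exp hΘ0 hΘ le_rfl).trans (Real.exp_le_exp.mpr ?_)
  linarith only [s2, Q1]

/-- `G₁ ≤ e^{-ℓ^a ℓ^g/24}`. [cite: Masser1975, Lemma 1.10] -/
theorem G₁_le : (D.run ℓ).G₁ ≤ Real.exp (-(ℓ ^ ea εS * ℓ ^ eg εS / 24)) := by
  change (D.run ℓ).Ggen (kOf ℓ) (hOf ℓ) ≤ _
  exact Ggen_le hL hL.h2a hL.h2g hL.hG1 hL.hG2

/-- `G₂ ≤ e^{-ℓ^{a₁} ℓ^{g₁}/24}`. [cite: Masser1975, Lemma 1.11] -/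
theorem G₂_le : (D.run ℓ).G₂ ≤ Real.exp (-(ℓ ^ ea₁ εS * ℓ ^ eg₁ εS / 24)) := by
  change (D.run ℓ).Ggen (k₁Of ℓ) (h₁Of ℓ) ≤ _
  exact Ggen_le hL hL.h2a₁ hL.h2g₁ hL.hH1 hL.hH2

omit hL in
/-- The `σ`-factor: `cσ⁻¹ e^{Cσ X} ≤ e^{Cb + Cb X}` for `X ≥ 0`. [folklore] -/
theorem sigma_factor_le {X : ℝ} (hX : 0 ≤ X) :
    D.K.cσ⁻¹ * Real.exp (D.K.Cσ * X) ≤ Real.exp (D.Cb + D.Cb * X) := by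
  obtain ⟨-, -, -, -, -, hCσ, hcσ, -⟩ := D.consts_le_Cb
  have h1 : D.K.cσ⁻¹ ≤ Real.exp D.Cb := by
    refine le_exp_of_log_le (inv_pos.mpr D.K.hcσ) ?_
    rw [Real.log_inv]
    exact (neg_le_abs _).trans hcσ
  exact mul_le_exp (inv_pos.mpr D.K.hcσ).le h1 (Real.exp_le_exp.mpr (mul_le_mul_of_nonneg_right hCσ hX))

/-- `κ n²/μ ≤ e^{14 Cb² ℓ}`. [cite: Masser1975, §1.3 (end of the proof of Thm I)] -/
theorem kappa_div_mu_le : 0 ≤ (D.run ℓ).K.κ * ((D.run ℓ).n : ℝ) ^ 2 / (D.run ℓ).μ ∧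
    (D.run ℓ).K.κ * ((D.run ℓ).n : ℝ) ^ 2 / (D.run ℓ).μ ≤ Real.exp (14 * D.Cb ^ 2 * ℓ) := by
  obtain ⟨-, hC6, -, hh6, -, -, -, -, hC, hκ, -, -, hT₀, -, -, -, hd⟩ := D.consts_le_Cb
  obtain ⟨hnle, -, hN⟩ := n_bounds hL
  have hn1 : (1 : ℝ) ≤ nOf ℓ := by
    have : 1 ≤ nOf ℓ := le_trans (by omega) hN
    exact_mod_cast this
  have hC1 : (1 : ℝ) ≤ D.K.C₁₀ := by exact_mod_cast D.K.hC₁₀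
  have hω : 0 < ‖D.S.L.ω₁‖ := norm_pos_iff.mpr (by simpa using basis_ne_zero D.S.L 0)
  have hκ0 := D.K.hκ
  have hC60 : 0 < D.S.C6 := lt_of_lt_of_le one_pos D.S.one_le_C6
  have hd0 : (D.S.d6 : ℝ) ≠ 0 := by exact_mod_cast D.S.G6.den_ne_zero
  have hX0 : (0 : ℝ) < ((D.K.C₁₀ * nOf ℓ : ℕ) : ℝ) := by push_cast; positivity
  set B : ℝ := 3 * ((D.K.C₁₀ * nOf ℓ : ℕ) : ℝ) * D.S.C6 ^ 2 with hB
  have hB0 : 0 < B := by positivity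
  have heq : (D.run ℓ).K.κ * ((D.run ℓ).n : ℝ) ^ 2 / (D.run ℓ).μ =
      D.K.κ * ((nOf ℓ : ℝ) * (nOf ℓ)) * (B ^ (D.S.G6.h - 1) * (D.S.d6 : ℝ) ^ 2) *
        (‖D.S.L.ω₁‖⁻¹ * ‖D.S.L.ω₁‖⁻¹) := by
    change D.K.κ * ((nOf ℓ : ℝ)) ^ 2 / (‖D.S.L.ω₁‖ ^ 2 *
      ((3 * ((D.K.C₁₀ * nOf ℓ : ℕ) : ℝ) * D.S.C6 ^ 2) ^ (D.S.G6.h - 1) * (D.S.d6 : ℝ) ^ 2)⁻¹) = _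
    rw [← hB]
    field_simp
  refine ⟨by rw [heq]; positivity, ?_⟩
  rw [heq]
  have hCb := D.one_le_Cb
  have hCb0 : 0 ≤ D.Cb := by linarith
  have hℓ := hL.hℓ
  obtain ⟨hδ1, hδℓ⟩ := ℓδ_bounds hL
  obtain ⟨-, e2, -⟩ := PData.exp_consts
  have fκ : D.K.κ ≤ Real.exp D.Cb := le_exp_of_log_le hκ0 ((le_abs_self _).trans hκ)
  have fn : (nOf ℓ : ℝ) ≤ Real.exp (ℓ ^ dδ εS) := by linarith [n_succ_le_exp hL]
  have fC : (D.K.C₁₀ : ℝ) ≤ Real.exp D.Cb := hC.trans (by linarith [Real.add_one_le_exp D.Cb])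
  have fC6 : D.S.C6 ^ 2 ≤ Real.exp (2 * D.Cb) := by
    have := pow_le_exp hC60.le (le_exp_of_log_le hC60 hC6) 2; simpa [mul_comm] using this
  have fB : B ≤ Real.exp (6 * D.Cb * ℓ ^ dδ εS) := by
    rw [hB]
    have f3 : (3 : ℝ) ≤ Real.exp 2 := by linarith
    have fX : ((D.K.C₁₀ * nOf ℓ : ℕ) : ℝ) ≤ Real.exp (D.Cb + ℓ ^ dδ εS) := by
      push_cast; exact mul_le_exp (by positivity) fC fn
    refine (mul_le_exp (by positivity) (mul_le_exp (by norm_num) f3 fX) fC6).trans (Real.exp_le_exp.mpr ?_)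
    nlinarith
  have fBpow : B ^ (D.S.G6.h - 1) ≤ Real.exp (D.Cb * (6 * D.Cb * ℓ ^ dδ εS)) := by
    refine (pow_le_exp hB0.le fB _).trans (Real.exp_le_exp.mpr (mul_le_mul_of_nonneg_right ?_ (by positivity)))
    have : ((D.S.G6.h - 1 : ℕ) : ℝ) ≤ D.S.G6.h := by exact_mod_cast Nat.sub_le _ _
    exact this.trans hh6
  have fd : (D.S.d6 : ℝ) ^ 2 ≤ Real.exp (D.Cb + D.Cb) := by
    have hd1 : 0 < |(D.S.d6 : ℝ)| := lt_of_lt_of_le one_pos D.S.G6.one_le_abs_den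
    have h1 : |(D.S.d6 : ℝ)| ≤ Real.exp D.Cb := le_exp_of_log_le hd1 hd
    have := mul_le_exp (abs_nonneg _) h1 h1
    rwa [← abs_mul, abs_mul_self, ← pow_two] at this
  have fω : ‖D.S.L.ω₁‖⁻¹ ≤ Real.exp D.Cb :=
    (le_max_right 1 _).trans (le_exp_of_log_le (lt_of_lt_of_le one_pos (le_max_left _ _)) hT₀)
  have step := mul_le_exp (by positivity)
    (mul_le_exp (by positivity) (mul_le_exp hκ0.le fκ (mul_le_exp (by positivity) fn fn))
      (mul_le_exp (by positivity) fBpow fd)) (mul_le_exp (by positivity) fω fω)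
  refine step.trans (Real.exp_le_exp.mpr ?_)
  have hCb2 : D.Cb ≤ D.Cb ^ 2 := le_self_pow₀ hCb two_ne_zero
  have e1 : D.Cb ^ 2 * ℓ ^ dδ εS ≤ D.Cb ^ 2 * ℓ := mul_le_mul_of_nonneg_left hδℓ (by positivity)
  have e2' : ℓ ^ dδ εS ≤ D.Cb ^ 2 * ℓ := hδℓ.trans (le_mul_of_one_le_left (by linarith) (one_le_pow₀ hCb))
  have e3 : D.Cb ≤ D.Cb ^ 2 * ℓ := hCb2.trans (le_mul_of_one_le_right (by positivity) hℓ)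
  nlinarith [e1, e2', e3]

/-- `MΦ ≤ e^{-Y₂} e^{4n(2Cb + Cb³ n²)}`. [cite: Masser1975, Lemma 1.11] -/
theorem MΦ_le : (D.run ℓ).MΦ ≤ Real.exp (-(ℓ ^ ea₁ εS * ℓ ^ eg₁ εS / 24)) *
    Real.exp (((4 * nOf ℓ : ℕ) : ℝ) * (D.Cb + D.Cb * (1 + (D.Cb * nOf ℓ) ^ 2))) := by
  obtain ⟨-, -, -, -, -, -, -, -, -, -, hR, -⟩ := D.consts_le_Cb
  have hG := G₂_le hL
  have hG0 : 0 ≤ (D.run ℓ).G₂ := (D.run ℓ).Ggen_nonneg _ _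
  have hf : D.K.cσ⁻¹ * Real.exp (D.K.Cσ * (1 + (D.K.R * nOf ℓ) ^ 2)) ≤
      Real.exp (D.Cb + D.Cb * (1 + (D.Cb * nOf ℓ) ^ 2)) := by
    refine (sigma_factor_le (D := D) (X := 1 + (D.K.R * nOf ℓ) ^ 2) (by positivity)).trans
      (Real.exp_le_exp.mpr ?_)
    have h1 : (D.K.R * nOf ℓ) ^ 2 ≤ (D.Cb * nOf ℓ) ^ 2 :=
      pow_le_pow_left₀ (mul_nonneg D.K.hR.le (Nat.cast_nonneg _)) (mul_le_mul_of_nonneg_right hR (Nat.cast_nonneg _)) 2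
    have hCb0 : 0 ≤ D.Cb := zero_le_one.trans D.one_le_Cb
    nlinarith
  change (D.run ℓ).G₂ * (D.K.cσ⁻¹ * Real.exp (D.K.Cσ * (1 + (D.K.R * nOf ℓ) ^ 2))) ^ (4 * nOf ℓ) ≤ _
  have hc0 : 0 ≤ D.K.cσ⁻¹ * Real.exp (D.K.Cσ * (1 + (D.K.R * nOf ℓ) ^ 2)) := by
    have := D.K.hcσ; positivity
  exact mul_le_mul hG (pow_le_exp hc0 hf _) (pow_nonneg hc0 _) (by positivity)

/-- `Pb₆^{h - 1} ≤ e^{14 Cb² k ℓ}`. [folklore] -/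
theorem Pb_pow_le : D.S.Pb6 (nOf ℓ) (kOf ℓ) ^ (D.S.G6.h - 1) ≤ Real.exp (D.Cb * (14 * D.Cb * kOf ℓ * ℓ)) := by
  obtain ⟨-, -, -, hh0, -⟩ := D.consts_le_Cb
  have h1 := pow_le_exp (zero_le_one.trans (D.S.one_le_Pb6 _ _)) (Pb6_le hL) (D.S.G6.h - 1)
  refine h1.trans (Real.exp_le_exp.mpr (mul_le_mul_of_nonneg_right ?_ ?_))
  · have : ((D.S.G6.h - 1 : ℕ) : ℝ) ≤ D.S.G6.h := by exact_mod_cast Nat.sub_le _ _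
    exact this.trans hh0
  · have := D.one_le_Cb; have := hL.hℓ; positivity

/-- **`hF`**: `(κ n²/μ)^n MΦ < Pb₆^{-(h-1)}`. [cite: Masser1975, §1.3 (end of the proof of Thm I)] -/
theorem hyp_F : ((D.run ℓ).K.κ * ((D.run ℓ).n : ℝ) ^ 2 / (D.run ℓ).μ) ^ (D.run ℓ).n * (D.run ℓ).MΦ <
    ((D.run ℓ).S.Pb6 (D.run ℓ).n (D.run ℓ).k ^ ((D.run ℓ).S.G6.h - 1))⁻¹ := by
  change _ < (D.S.Pb6 (nOf ℓ) (kOf ℓ) ^ (D.S.G6.h - 1))⁻¹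
  have hPb0 : 0 < D.S.Pb6 (nOf ℓ) (kOf ℓ) ^ (D.S.G6.h - 1) := pow_pos (lt_of_lt_of_le one_pos (D.S.one_le_Pb6 _ _)) _
  rw [inv_eq_one_div, lt_div_iff₀ hPb0]
  obtain ⟨hq0, hq⟩ := kappa_div_mu_le hL
  have f1 := pow_le_exp hq0 hq (nOf ℓ)
  have f2 := MΦ_le hL
  have f3 := Pb_pow_le hL
  have hM0 : 0 ≤ (D.run ℓ).MΦ := by
    change 0 ≤ (D.run ℓ).G₂ * (D.K.cσ⁻¹ * Real.exp (D.K.Cσ * (1 + (D.K.R * nOf ℓ) ^ 2))) ^ (4 * nOf ℓ)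
    have := (D.run ℓ).Ggen_nonneg (k₁Of ℓ) (h₁Of ℓ)
    have := D.K.hcσ
    change 0 ≤ (D.run ℓ).Ggen (k₁Of ℓ) (h₁Of ℓ) * _
    positivity
  set Y := ℓ ^ ea₁ εS * ℓ ^ eg₁ εS / 24 with hY
  have e2 : (D.run ℓ).MΦ ≤ Real.exp (-Y + ((4 * nOf ℓ : ℕ) : ℝ) * (D.Cb + D.Cb * (1 + (D.Cb * nOf ℓ) ^ 2))) := by
    refine f2.trans (le_of_eq ?_); rw [Real.exp_add]
  have step := mul_le_exp (mul_nonneg (pow_nonneg hq0 _) hM0) (mul_le_exp (pow_nonneg hq0 _) f1 e2) f3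
  change ((D.run ℓ).K.κ * ((D.run ℓ).n : ℝ) ^ 2 / (D.run ℓ).μ) ^ nOf ℓ * (D.run ℓ).MΦ *
      D.S.Pb6 (nOf ℓ) (kOf ℓ) ^ (D.S.G6.h - 1) < 1
  refine lt_of_le_of_lt step ?_
  -- the exponent is `≤ -2`
  obtain ⟨hnle, -, hN⟩ := n_bounds hL
  obtain ⟨hkle, -, -⟩ := k_bounds hL
  have hCb := D.one_le_Cb
  have hCb0 : 0 ≤ D.Cb := by linarith
  have hℓ := hL.hℓ
  have hℓ0 := ℓ_pos hL
  have hH1 := hL.hH1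
  have hH3 := hL.hH3
  have hH4 := hL.hH4
  rw [rpow_add' hL, Real.rpow_one, rpow_add' hL] at hH1 hH4
  rw [rpow_three' hL, rpow_add' hL] at hH3
  have hb1 : 1 ≤ ℓ ^ eb εS := one_le_rpow' hL (exps).2.2.2.2.2.2.2.2.1.le
  have hn0 : (0 : ℝ) ≤ nOf ℓ := Nat.cast_nonneg _
  have m1 : D.Cb ^ 2 * (nOf ℓ : ℝ) * ℓ ≤ D.Cb ^ 2 * (ℓ ^ eb εS * ℓ) := by
    have := mul_le_mul_of_nonneg_left (mul_le_mul_of_nonneg_right hnle hℓ0.le) (pow_nonneg hCb0 2); linarith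
  have m2 : D.Cb * (nOf ℓ : ℝ) ≤ D.Cb ^ 2 * (ℓ ^ eb εS * ℓ) := by
    have h1 : (nOf ℓ : ℝ) ≤ ℓ ^ eb εS * ℓ := hnle.trans (le_mul_of_one_le_right (by positivity) hℓ)
    have h2 : D.Cb * (nOf ℓ : ℝ) ≤ D.Cb * (ℓ ^ eb εS * ℓ) := mul_le_mul_of_nonneg_left h1 hCb0
    have h3 : D.Cb * (ℓ ^ eb εS * ℓ) ≤ D.Cb ^ 2 * (ℓ ^ eb εS * ℓ) :=
      mul_le_mul_of_nonneg_right (le_self_pow₀ hCb two_ne_zero) (by positivity)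
    linarith
  have m3 : D.Cb ^ 3 * (nOf ℓ : ℝ) ^ 3 ≤ D.Cb ^ 3 * (ℓ ^ eb εS * ℓ ^ eb εS * ℓ ^ eb εS) := by
    have : (nOf ℓ : ℝ) ^ 3 ≤ (ℓ ^ eb εS) ^ 3 := pow_le_pow_left₀ hn0 hnle 3
    have h3 : (ℓ ^ eb εS) ^ 3 = ℓ ^ eb εS * ℓ ^ eb εS * ℓ ^ eb εS := by ring
    rw [← h3]; exact mul_le_mul_of_nonneg_left this (by positivity)
  have m4 : D.Cb ^ 2 * (kOf ℓ : ℝ) * ℓ ≤ D.Cb ^ 2 * (ℓ ^ ea εS * ℓ) := by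
    have := mul_le_mul_of_nonneg_left (mul_le_mul_of_nonneg_right hkle hℓ0.le) (pow_nonneg hCb0 2); linarith
  have m5 : 1 ≤ D.Cb ^ 2 * (ℓ ^ eb εS * ℓ) := by
    have : (1 : ℝ) ≤ D.Cb ^ 2 := one_le_pow₀ hCb
    have : (1 : ℝ) ≤ ℓ ^ eb εS * ℓ := one_le_mul_of_one_le_of_one_le hb1 hℓ
    nlinarith
  have hexp : ((nOf ℓ : ℕ) : ℝ) * (14 * D.Cb ^ 2 * ℓ) + (-Y + ((4 * nOf ℓ : ℕ) : ℝ) *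
      (D.Cb + D.Cb * (1 + (D.Cb * nOf ℓ) ^ 2))) + D.Cb * (14 * D.Cb * kOf ℓ * ℓ) ≤ -2 := by
    push_cast
    have hYAG : 0 ≤ ℓ ^ ea₁ εS * ℓ ^ eg₁ εS := by positivity
    nlinarith [m1, m2, m3, m4, m5, hH1, hH3, hH4]
  calc Real.exp _ ≤ Real.exp (-2) := Real.exp_le_exp.mpr hexp
    _ < 1 := by rw [Real.exp_lt_one_iff]; norm_num

end RunBounds


section RunBounds2

variable {D} {ℓ : ℝ} (hL : D.LargeL ℓ)
include hL

/-! #### The Liouville inequality `hL1` -/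

/-- `Bc ≤ e^{26 Cb k₁ ℓ}`. [cite: Masser1975, §1.3 (Lemma 1.10: "size at most H^{c₂₁k₁}")] -/
theorem Bc_le : (D.run ℓ).Bc ≤ Real.exp (26 * D.Cb * k₁Of ℓ * ℓ) := by
  obtain ⟨hnk, hkk₁, hnk₁, -, -, -⟩ := params_order hL
  obtain ⟨hk₁le, -, hk₁1⟩ := k₁_bounds hL
  have hCb := D.one_le_Cb
  have hℓ := hL.hℓ
  obtain ⟨hδ1, hδℓ⟩ := ℓδ_bounds hL
  have hsq : ((((nOf ℓ) + 1) ^ 2 : ℕ) : ℝ) ≤ Real.exp (2 * ℓ ^ dδ εS) := by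
    have h := pow_le_exp (by positivity) (n_succ_le_exp hL) 2
    push_cast at h ⊢; simpa using h
  have hA := Amat6_le hL hnk₁ hk₁1 hk₁le
  have hP := Pb6_le hL
  have hkk₁' : (kOf ℓ : ℝ) ≤ k₁Of ℓ := by exact_mod_cast hkk₁
  have hk₁1' : (1 : ℝ) ≤ k₁Of ℓ := by exact_mod_cast hk₁1
  change ((((nOf ℓ) + 1) ^ 2 : ℕ) : ℝ) * D.S.Pb6 (nOf ℓ) (kOf ℓ) * D.S.Amat6 (nOf ℓ) (k₁Of ℓ) ≤ _
  have hPb0 : 0 ≤ D.S.Pb6 (nOf ℓ) (kOf ℓ) := zero_le_one.trans (D.S.one_le_Pb6 _ _)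
  refine (mul_le_exp (mul_nonneg (by positivity) hPb0) (mul_le_exp (by positivity) hsq hP) hA).trans
    (Real.exp_le_exp.mpr ?_)
  obtain ⟨-, -, -, -, d5, -⟩ := dom hk₁1' hCb hℓ (by linarith) hδℓ
  have : D.Cb * (kOf ℓ : ℝ) * ℓ ≤ D.Cb * (k₁Of ℓ) * ℓ := by
    have := mul_le_mul_of_nonneg_left (mul_le_mul_of_nonneg_right hkk₁' (by linarith : (0:ℝ) ≤ ℓ)) (by linarith : 0 ≤ D.Cb)
    linarith
  nlinarith

/-- `Bc^{h-1} ≤ e^{26 Cb² k₁ ℓ}`. [folklore] -/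
theorem Bc_pow_le : (D.run ℓ).Bc ^ ((D.run ℓ).S.G6.h - 1) ≤ Real.exp (D.Cb * (26 * D.Cb * k₁Of ℓ * ℓ)) := by
  obtain ⟨-, -, -, hh0, -⟩ := D.consts_le_Cb
  have hBc1 : 1 ≤ (D.run ℓ).Bc := by
    change 1 ≤ ((((nOf ℓ) + 1) ^ 2 : ℕ) : ℝ) * D.S.Pb6 (nOf ℓ) (kOf ℓ) * D.S.Amat6 (nOf ℓ) (k₁Of ℓ)
    have hq : (1 : ℝ) ≤ ((((nOf ℓ) + 1) ^ 2 : ℕ) : ℝ) := by exact_mod_cast Nat.one_le_pow _ _ (by omega)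
    exact one_le_mul_of_one_le_of_one_le (one_le_mul_of_one_le_of_one_le hq (D.S.one_le_Pb6 _ _))
      (D.S.one_le_Amat6 _ _)
  have h1 := pow_le_exp (zero_le_one.trans hBc1) (Bc_le hL) ((D.run ℓ).S.G6.h - 1)
  refine h1.trans (Real.exp_le_exp.mpr (mul_le_mul_of_nonneg_right ?_ ?_))
  · have : (((D.run ℓ).S.G6.h - 1 : ℕ) : ℝ) ≤ D.S.G6.h := by exact_mod_cast Nat.sub_le _ _
    exact this.trans hh0
  · have := D.one_le_Cb; have := hL.hℓ; positivity

/-- `|d|^{2n+2k₁} ≤ e^{4 Cb k₁ ℓ}`. [folklore] -/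
theorem d_pow_le : (|(D.S.d6 : ℝ)|) ^ (2 * nOf ℓ + 2 * k₁Of ℓ) ≤ Real.exp (4 * D.Cb * k₁Of ℓ * ℓ) := by
  obtain ⟨-, -, -, -, -, -, -, -, -, -, -, -, -, -, -, -, hd⟩ := D.consts_le_Cb
  obtain ⟨-, -, hnk₁, -⟩ := params_order hL
  have hnk₁' : (nOf ℓ : ℝ) ≤ k₁Of ℓ := by exact_mod_cast hnk₁
  have hCb := D.one_le_Cb
  have hℓ := hL.hℓ
  have hd1 : 0 < |(D.S.d6 : ℝ)| := lt_of_lt_of_le one_pos D.S.G6.one_le_abs_den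
  have fd : |(D.S.d6 : ℝ)| ≤ Real.exp D.Cb := le_exp_of_log_le hd1 hd
  refine (pow_le_exp (abs_nonneg _) fd _).trans (Real.exp_le_exp.mpr ?_)
  push_cast
  have hk0 : (0 : ℝ) ≤ k₁Of ℓ := Nat.cast_nonneg _
  have h1 : (2 * (nOf ℓ : ℝ) + 2 * k₁Of ℓ) * D.Cb ≤ 4 * ((k₁Of ℓ : ℝ) * D.Cb) := by nlinarith
  have h2 : (k₁Of ℓ : ℝ) * D.Cb ≤ (k₁Of ℓ : ℝ) * D.Cb * ℓ := le_mul_of_one_le_right (by positivity) hℓ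
  linarith

/-- `B₁ ≤ e^{-Y₁} e^{12 Cb n}`. [cite: Masser1975, Lemma 1.10] -/
theorem B₁_le : 0 ≤ (D.run ℓ).B₁ ∧ (D.run ℓ).B₁ ≤ Real.exp (-(ℓ ^ ea εS * ℓ ^ eg εS / 24)) *
    Real.exp (((4 * nOf ℓ : ℕ) : ℝ) * (D.Cb + D.Cb * 2)) := by
  have hG := G₁_le hL
  have hG0 : 0 ≤ (D.run ℓ).G₁ := (D.run ℓ).Ggen_nonneg _ _
  have hf := sigma_factor_le (D := D) (X := 2) (by norm_num)
  have hc0 : 0 ≤ D.K.cσ⁻¹ * Real.exp (D.K.Cσ * 2) := by have := D.K.hcσ; positivity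
  change 0 ≤ (D.run ℓ).G₁ * (D.K.cσ⁻¹ * Real.exp (D.K.Cσ * 2)) ^ (4 * nOf ℓ) ∧
    (D.run ℓ).G₁ * (D.K.cσ⁻¹ * Real.exp (D.K.Cσ * 2)) ^ (4 * nOf ℓ) ≤ _
  exact ⟨mul_nonneg hG0 (pow_nonneg hc0 _),
    mul_le_mul hG (pow_le_exp hc0 hf _) (pow_nonneg hc0 _) (by positivity)⟩

/-- `U ≤ e^{Za}` with the explicit exponent. [cite: Masser1975, Lemma 1.10] -/
theorem U_le : (D.run ℓ).U ≤
    Real.exp ((k₁Of ℓ : ℝ) * D.Cb + (k₁Of ℓ : ℝ) * ℓ ^ dδ εS +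
      (-(ℓ ^ ea εS * ℓ ^ eg εS / 24) + ((4 * nOf ℓ : ℕ) : ℝ) * (D.Cb + D.Cb * 2)) + (k₁Of ℓ : ℝ) * D.Cb) := by
  obtain ⟨-, -, -, -, -, -, -, -, -, -, -, hρ, hT₀, -⟩ := D.consts_le_Cb
  obtain ⟨-, -, hnk₁, -, -, -⟩ := params_order hL
  obtain ⟨hk₁le, -, hk₁1⟩ := k₁_bounds hL
  obtain ⟨hB0, hB⟩ := B₁_le hL
  have fT₀ : (D.run ℓ).T₀ ^ k₁Of ℓ ≤ Real.exp ((k₁Of ℓ : ℝ) * D.Cb) :=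
    pow_le_exp (zero_le_one.trans (le_max_left _ _)) (le_exp_of_log_le (lt_of_lt_of_le one_pos (le_max_left _ _)) hT₀) _
  have fk : ((k₁Of ℓ).factorial : ℝ) ≤ Real.exp ((k₁Of ℓ : ℝ) * ℓ ^ dδ εS) := by
    have h1 : ((k₁Of ℓ).factorial : ℝ) ≤ (k₁Of ℓ : ℝ) ^ k₁Of ℓ := by exact_mod_cast Nat.factorial_le_pow _
    refine h1.trans (pow_le_exp (Nat.cast_nonneg _) ?_ _)
    have : (k₁Of ℓ : ℝ) + 1 ≤ Real.exp (ℓ ^ dδ εS) :=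
      le_exp_of_log_le (by positivity) (log_small hL (by positivity) hk₁le hk₁le (by nlinarith [Nat.cast_nonneg (α := ℝ) (k₁Of ℓ)]))
    linarith
  have fρ : (D.K.d.ρ⁻¹) ^ k₁Of ℓ ≤ Real.exp ((k₁Of ℓ : ℝ) * D.Cb) :=
    pow_le_exp (inv_pos.mpr D.K.d.ρ_pos).le (le_exp_of_log_le (inv_pos.mpr D.K.d.ρ_pos) hρ) _
  have fB : (D.run ℓ).B₁ ≤ Real.exp (-(ℓ ^ ea εS * ℓ ^ eg εS / 24) + ((4 * nOf ℓ : ℕ) : ℝ) * (D.Cb + D.Cb * 2)) := by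
    refine hB.trans (le_of_eq ?_); rw [Real.exp_add]
  change (D.run ℓ).T₀ ^ k₁Of ℓ * ((k₁Of ℓ).factorial * (D.run ℓ).B₁ / D.K.d.ρ ^ k₁Of ℓ) ≤ _
  rw [div_eq_mul_inv, ← inv_pow]
  have := mul_le_exp (pow_nonneg (zero_le_one.trans (le_max_left _ _)) _) fT₀
    (mul_le_exp (mul_nonneg (Nat.cast_nonneg _) hB0) (mul_le_exp (Nat.cast_nonneg _) fk fB) fρ)
  refine this.trans (le_of_eq ?_)
  ring_nf

/-- **`hL1`**: `|d|^{2n+2k₁} U < Λ₁ = Bc^{-(h-1)}`. [cite: Masser1975, §1.3 (proof of Lemma 1.10)] -/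
theorem hyp_L1 : (|((D.run ℓ).S.d6 : ℝ)|) ^ (2 * (D.run ℓ).n + 2 * (D.run ℓ).k₁) * (D.run ℓ).U < (D.run ℓ).Λ₁ := by
  have hBc1 : 1 ≤ (D.run ℓ).Bc := by
    change 1 ≤ ((((nOf ℓ) + 1) ^ 2 : ℕ) : ℝ) * D.S.Pb6 (nOf ℓ) (kOf ℓ) * D.S.Amat6 (nOf ℓ) (k₁Of ℓ)
    have hq : (1 : ℝ) ≤ ((((nOf ℓ) + 1) ^ 2 : ℕ) : ℝ) := by exact_mod_cast Nat.one_le_pow _ _ (by omega)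
    exact one_le_mul_of_one_le_of_one_le (one_le_mul_of_one_le_of_one_le hq (D.S.one_le_Pb6 _ _))
      (D.S.one_le_Amat6 _ _)
  have hW0 : 0 < (D.run ℓ).Bc ^ ((D.run ℓ).S.G6.h - 1) := pow_pos (lt_of_lt_of_le one_pos hBc1) _
  unfold Run6.Λ₁
  rw [inv_eq_one_div, lt_div_iff₀ hW0]
  have hW := Bc_pow_le hL
  have hd := d_pow_le hL
  have hU := U_le hL
  have hU0 : 0 ≤ (D.run ℓ).U := by
    change 0 ≤ (D.run ℓ).T₀ ^ k₁Of ℓ * ((k₁Of ℓ).factorial * (D.run ℓ).B₁ / D.K.d.ρ ^ k₁Of ℓ)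
    have := (B₁_le hL).1
    have : 0 ≤ (D.run ℓ).T₀ ^ k₁Of ℓ := pow_nonneg (zero_le_one.trans (le_max_left _ _)) _
    have := D.K.d.ρ_pos
    positivity
  change (|(D.S.d6 : ℝ)|) ^ (2 * nOf ℓ + 2 * k₁Of ℓ) * (D.run ℓ).U * (D.run ℓ).Bc ^ ((D.run ℓ).S.G6.h - 1) < 1
  have hprod := mul_le_exp (mul_nonneg (by positivity) hU0) (mul_le_exp (by positivity) hd hU) hW
  refine lt_of_le_of_lt hprod ?_
  -- the exponent is `≤ -2`
  obtain ⟨hnle, -, hN⟩ := n_bounds hL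
  obtain ⟨hk₁le, -, hk₁1⟩ := k₁_bounds hL
  obtain ⟨-, -, hnk₁, -⟩ := params_order hL
  have hnk₁' : (nOf ℓ : ℝ) ≤ k₁Of ℓ := by exact_mod_cast hnk₁
  have hCb := D.one_le_Cb
  have hCb0 : 0 ≤ D.Cb := by linarith
  have hℓ := hL.hℓ
  have hℓ0 := ℓ_pos hL
  obtain ⟨hδ1, hδℓ⟩ := ℓδ_bounds hL
  have hG3 := hL.hG3
  rw [rpow_add' hL, Real.rpow_one, rpow_add' hL] at hG3
  -- everything is `≤ M = Cb² A₁ ℓ`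
  have hA₁1 : 1 ≤ ℓ ^ ea₁ εS := by linarith [hL.h2a₁]
  have hM1 : 1 ≤ D.Cb ^ 2 * (ℓ ^ ea₁ εS * ℓ) :=
    one_le_mul_of_one_le_of_one_le (one_le_pow₀ hCb) (one_le_mul_of_one_le_of_one_le hA₁1 hℓ)
  have hCb2 : D.Cb ≤ D.Cb ^ 2 := le_self_pow₀ hCb two_ne_zero
  have hk₁ℓ : (k₁Of ℓ : ℝ) * ℓ ≤ ℓ ^ ea₁ εS * ℓ := mul_le_mul_of_nonneg_right hk₁le hℓ0.le
  have v3 : D.Cb ^ 2 * ((k₁Of ℓ : ℝ) * ℓ) ≤ D.Cb ^ 2 * (ℓ ^ ea₁ εS * ℓ) := mul_le_mul_of_nonneg_left hk₁ℓ (by positivity)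
  have v1 : D.Cb * ((k₁Of ℓ : ℝ) * ℓ) ≤ D.Cb ^ 2 * (ℓ ^ ea₁ εS * ℓ) := by
    have := mul_le_mul hCb2 hk₁ℓ (by positivity) (by positivity); linarith
  have v4 : D.Cb * (k₁Of ℓ : ℝ) ≤ D.Cb ^ 2 * (ℓ ^ ea₁ εS * ℓ) := by
    have : D.Cb * (k₁Of ℓ : ℝ) ≤ D.Cb * ((k₁Of ℓ : ℝ) * ℓ) := by
      have := le_mul_of_one_le_right (by positivity : 0 ≤ D.Cb * (k₁Of ℓ : ℝ)) hℓ; linarith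
    linarith
  have v5 : (k₁Of ℓ : ℝ) * ℓ ^ dδ εS ≤ D.Cb ^ 2 * (ℓ ^ ea₁ εS * ℓ) :=
    le_trans (mul_le_mul_of_nonneg_left hδℓ (by positivity))
      (hk₁ℓ.trans (le_mul_of_one_le_left (by positivity) (one_le_pow₀ hCb)))
  have v6 : D.Cb * (nOf ℓ : ℝ) ≤ D.Cb ^ 2 * (ℓ ^ ea₁ εS * ℓ) := le_trans (mul_le_mul_of_nonneg_left hnk₁' hCb0) v4
  have hAG0 : 0 ≤ ℓ ^ ea εS * ℓ ^ eg εS := by positivity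
  have hexp : 4 * D.Cb * k₁Of ℓ * ℓ + ((k₁Of ℓ : ℝ) * D.Cb + (k₁Of ℓ : ℝ) * ℓ ^ dδ εS +
      (-(ℓ ^ ea εS * ℓ ^ eg εS / 24) + ((4 * nOf ℓ : ℕ) : ℝ) * (D.Cb + D.Cb * 2)) + (k₁Of ℓ : ℝ) * D.Cb) +
      D.Cb * (26 * D.Cb * k₁Of ℓ * ℓ) ≤ -2 := by
    push_cast
    linarith [v1, v3, v4, v5, v6, hM1, hG3]
  calc Real.exp _ ≤ Real.exp (-2) := Real.exp_le_exp.mpr hexp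
    _ < 1 := by rw [Real.exp_lt_one_iff]; norm_num

/-! #### The easy fields and all of `Hyp` -/

/-- `2(k+1) ≤ (n+1)²`. [cite: Masser1975, §1.3 (Lemma 1.8)] -/
theorem hyp_siegel : 2 * ((D.run ℓ).k + 1) ≤ ((D.run ℓ).n + 1) ^ 2 := by
  change 2 * (kOf ℓ + 1) ≤ (nOf ℓ + 1) ^ 2
  obtain ⟨hkle, -, -⟩ := k_bounds hL
  obtain ⟨-, hnge, -⟩ := n_bounds hL
  have hS1 := hL.hS1
  rw [rpow_two' hL] at hS1
  have h2a := hL.h2a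
  have hreal : (2 : ℝ) * ((kOf ℓ : ℝ) + 1) ≤ ((nOf ℓ : ℝ) + 1) ^ 2 := by
    have h1 : ℓ ^ eb εS / 2 ≤ (nOf ℓ : ℝ) + 1 := by linarith
    have hb0 : 0 ≤ ℓ ^ eb εS := Real.rpow_nonneg (ℓ_pos hL).le _
    have h2 : (ℓ ^ eb εS / 2) ^ 2 ≤ ((nOf ℓ : ℝ) + 1) ^ 2 := pow_le_pow_left₀ (by positivity) h1 2
    nlinarith
  exact_mod_cast hreal

/-- `R n ≤ h₁ + 1`. [cite: Masser1975, §1.3 (Lemma 1.11)] -/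
theorem hyp_P1 : (D.run ℓ).K.R * (D.run ℓ).n ≤ ((D.run ℓ).h₁ : ℝ) + 1 := by
  change D.K.R * (nOf ℓ : ℝ) ≤ (h₁Of ℓ : ℝ) + 1
  obtain ⟨-, -, -, -, -, -, -, -, -, -, hR, -⟩ := D.consts_le_Cb
  obtain ⟨hnle, -, -⟩ := n_bounds hL
  obtain ⟨-, hh₁ge, -⟩ := h₁_bounds hL
  have hS2 := hL.hS2
  have : D.K.R * (nOf ℓ : ℝ) ≤ D.Cb * ℓ ^ eb εS := mul_le_mul hR hnle (Nat.cast_nonneg _) (zero_le_one.trans D.one_le_Cb)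
  linarith

/-- **The parameters satisfy every inequality of the run** once `ℓ` is large. [cite: Masser1975, §1.3] -/
theorem run_hyp : (D.run ℓ).Hyp where
  hk := (k_bounds hL).2.2
  hkk₁ := (params_order hL).2.1
  hn := le_trans (Nat.le_succ _) (n_bounds hL).2.2
  hh := (h_bounds hL).2.2
  hh₁ := (h₁_bounds hL).2.2
  hsiegel := hyp_siegel hL
  hP1 := hyp_P1 hL
  hL1 := hyp_L1 hL
  hF := hyp_F hL

end RunBounds2

end PData6

/-! ### `τ` is transcendental -/

/-- **`ω₂/ω₁` is transcendental** for a lattice with algebraic invariants and without complex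
multiplication (Schneider 1937; the qualitative content of Masser's Theorem I, used in the proof of
Theorem II: "`β̄₁ω₁ + β̄₂ω₂ ≠ 0` since `β₂ ≠ 0` and `ω₂/ω₁` is transcendental", p. 26). Proof:
an integer quadratic relation would give complex multiplication (`hasCM_of_quadratic`); otherwise
the run `Run6` at a large `ℓ` is contradictory. [cite: Masser1975, Thm I (qualitative) / §2.5 p. 26] -/
theorem transcendental_tau (S : TSetup) (hCM : ¬ S.L.HasCM) : Transcendental ℚ (S.L.ω₂ / S.L.ω₁) := by
  intro hτ
  by_cases hquad : ∃ A B C : ℤ, (A, B, C) ≠ (0, 0, 0) ∧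
      (A : ℂ) + (B : ℂ) * (S.L.ω₂ / S.L.ω₁) + (C : ℂ) * (S.L.ω₂ / S.L.ω₁) ^ 2 = 0
  · obtain ⟨A, B, C, h0, h⟩ := hquad
    exact hCM (hasCM_of_quadratic S.L h0 h)
  · push Not at hquad
    let A : ASetup := ⟨S, hτ, fun A B C h0 => hquad A B C h0⟩
    obtain ⟨K⟩ := exists_consts S.L
    let D : PData6 := ⟨A, K⟩
    obtain ⟨ℓ₀, hℓ₀⟩ := Filter.eventually_atTop.mp D.eventually_largeL
    exact (D.run ℓ₀).contradiction (PData6.run_hyp (hℓ₀ ℓ₀ le_rfl))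

end Literature.NumberTheory.Transcendental.Masser1975
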